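/-
Copyright (c) 2026. Released under the Apache 2.0 license.
-/
import Literature.NumberTheory.EllipticCurves.QuadraticTwistTateFormTwoProofs
import Literature.NumberTheory.EllipticCurves.QuadraticTwistLocalPolynomialProofs
import Literature.NumberTheory.EllipticCurves.QuadraticTwistLFunctionProofs
import Literature.NumberTheory.EllipticCurves.QuadraticTwistKroneckerLFunctionProofs
import Literature.NumberTheory.EllipticCurves.SzpiroLocalDataProofs
import Literature.NumberTheory.EllipticCurves.LFunctionPrimeCoeff
import Literature.NumberTheory.EllipticCurves.RootNumberTwistProofs
import HarnessLib

/-!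
# The twists RAMIFIED AT `2` of a curve semistable at `2`: the equation
# `W^{(4d)} = (0, d b₂, 0, 8d² b₄, 16d³ b₆)`, `d ∈ {−1, 2, −2}`, is GLOBALLY MINIMAL (Stevens' `η = 1`)

[Proofs] Theorems only (no definition, no named fact; D-0026). Topic
`Literature/NumberTheory/EllipticCurves`; namespaces `WeierstrassCurve` (deliberate dot-notation
extensions of the Mathlib namespace, as in `LocalReductionKrausTwo`, `QuadraticTwistTateFormTwoProofs`)
and `Literature.NumberTheory.EllipticCurves`.

G. Stevens, *Stickelberger elements and modular parametrizations of elliptic curves*, Invent.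
Math. 98 (1989), Lemma (5.2) p. 96: for a quadratic character `ψ` unramified outside the primes
where `A/ℚ` is semistable, `ℒ(A^ψ) = (η/τ(ψ)) ℒ(A)` with `η = 2` iff `8 ∣ cond(ψ)` and `A` is good
SUPERSINGULAR at `2`, `η = 1` otherwise ("Sketch of Proof: … reduces the calculation of `η` to an
application of Tate's algorithm"). The tree proves the case of odd conductor
(`ManinConstantQuadraticTwistStevensHoldsProofs`: the integral twist model by `q*` is globally
minimal). This file does the "application of Tate's algorithm" AT `2`, i.e. for the characters
`χ₋₄`, `χ₈`, `χ₋₈` (`ψ ↔ ℚ(√d)`, `d ∈ {−1, 2, −2}`), in the cases `η = 1` that are decided by the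
reduction TYPE at `2` (good-or-multiplicative, and for `d = ±2` multiplicative) or by the parity of
`a₁` (odd = good ordinary or multiplicative):

* The model. For `W/ℚ` globally minimal with integer model `M = integralModelInt W`, the tree's
  twisted equation `W.quadraticTwist (4d) = (0, d b₂, 0, 8 d² b₄, 16 d³ b₆)` (`QuadraticTwist.lean`:
  `y² = x³ + D(b₂/4)x² + D²(b₄/2)x + D³(b₆/4)` at `D = 4d`) has integer coefficients
  (`isIntegralAt_quadraticTwist_four_mul`, `isIntegral_ringOfIntegers_quadraticTwist_four_mul`)
  and `c₄ = 16d² c₄(M)`, `c₆ = 64d³ c₆(M)`, `Δ = 2¹² d⁶ Δ(M)`; it is `ℚ`-isomorphic to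
  `W.quadraticTwist d` (`exists_variableChange_quadraticTwist_mul_sq`).
* Odd places (`isMinimalAt_quadraticTwist_intCast_of_odd_of_not_dvd`,
  `isMinimalAt_quadraticTwist_four_mul_of_odd_place`): at `v ∤ 2`, `4d` is a `v`-unit and the
  twist of the `v`-minimal `W ⊗ ℚ_v` by a unit is minimal (`isMinimal_quadraticTwist`; Pal 2012
  Prop. 2.5, "`u_ℓ = 1`"; Silverman *AEC* VII.1.3).
* The place `2` (Kraus 1989 Prop. 2, necessity = tree `kraus_two_of_integral`: an integral equation
  has `c₆ ≡ −1 (mod 4)`, or `16 ∣ c₄` and `c₆ ≡ 0, 8 (mod 32)`). Parities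
  (`odd_c₄_of_odd_a₁`, `exists_c₆_eq_of_odd_a₁`, `sixteen_dvd_c₄_of_even_a₁`,
  `exists_c₆_eq_of_even_a₁_of_odd_a₃`, `odd_Δ_of_even_a₁_of_odd_a₃`,
  `two_dvd_c₄_and_two_dvd_Δ_of_even_a₁_of_even_a₃`): a minimal equation semistable at `2` has
  `a₁` odd (then `c₄` odd, `c₆ ≡ −1 (mod 4)`) or `a₁` even and `a₃` odd (then `16 ∣ c₄`,
  `c₆ ≡ 8 (mod 32)`, `Δ` odd); multiplicative forces `a₁` odd
  (`odd_a₁_or_odd_a₃_of_semistableAtTwo`, `odd_a₁_of_hasMultiplicativeReductionAtPrime_two`).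
  A descent `u` of the twisted equation has `u = 2w`, `w` a `2`-adic unit (`|c₄| > 2⁻⁸`, tree
  `isMinimal_of_kraus_fails`; or `|Δ| > 2⁻²⁴`, `isMinimal_of_kraus_fails_of_valuation_Δ` here), and
  the descended invariants `(d² c₄(M)/w⁴, d³ c₆(M)/w⁶)` violate Kraus's condition:
  `a₁` odd: `16 ∤ d² c₄(M)/w⁴` and `c₆' + 1` has valuation `2⁻¹` (`d = −1`: `w⁶ − c₆ = (w⁶ − 1) + 2(1 − 2m)`)
  resp. `1` (`d = ±2`) — `isMinimalAt_two_quadraticTwist_four_mul_of_odd_a₁`; `a₁` even, `a₃` odd,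
  `d = −1`: `|c₆'| = 2⁻³`, `|c₆' − 8| = 2⁻⁴`, `c₆' + 1` a unit —
  `isMinimalAt_two_quadraticTwist_neg_four_of_even_a₁_of_odd_a₃`. (For `d = ±2` and `a₁` even
  Kraus's condition HOLDS for the descended pair: that is Stevens' `η = 2`, not treated.)
* Assembly: `isGloballyMinimal_quadraticTwist_four_mul_of_odd_a₁` (`a₁` odd, all three `d`),
  `isGloballyMinimal_quadraticTwist_neg_four_of_semistable` (`d = −1`, `W` good or multiplicative
  at `2`), `isGloballyMinimal_quadraticTwist_four_mul` (`W` semistable at `2` and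
  `d = −1 ∨ W multiplicative at 2`).

The consumer is `ManinConstantQuadraticTwistAtTwoProofs` (Stevens (5.2) at `2` as a lattice
statement, and `2 ∤ c₀` for the twisted classes). Everything is proved; no definitions.

## References
* [Stevens1989] G. Stevens, *Stickelberger elements and modular parametrizations of elliptic
  curves*, Invent. Math. 98 (1989) 75–106, Lemma (5.2) p. 96 (statement and sketch of proof).
* [Kraus1989] A. Kraus, *Quelques remarques à propos des invariants c₄, c₆ et Δ d'une courbe
  elliptique*, Acta Arith. 54 (1989) 75–80, Prop. 2.
* [Pal2012] V. Pal, *Periods of quadratic twists of elliptic curves*, Proc. AMS 140 (2012),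
  Prop. 2.4, Prop. 2.5.
* [SilvermanAEC2009] J. H. Silverman, *The Arithmetic of Elliptic Curves*, 2nd ed. (2009), III.1
  Table 3.1, VII.1 Remark 1.1 and Prop. 1.3, VII.5 Prop. 5.1, VIII.8.
* [CremonaAlgorithms1997] J. E. Cremona, *Algorithms for Modular Elliptic Curves*, 2nd ed. (1997),
  §3.2 (Laska–Kraus–Connell).
-/

noncomputable section

open scoped Classical

open WeierstrassCurve IsDedekindDomain IsDedekindDomain.HeightOneSpectrum NumberField Rat.HeightOneSpectrum

namespace Literature.NumberTheory.EllipticCurves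

/-! ### Parities of `c₄`, `c₆`, `Δ` of an integral equation from those of `a₁`, `a₃` -/

section Parity

variable (M : WeierstrassCurve ℤ)

/-- `a₁` odd ⟹ `c₄` odd (`b₂ = a₁² + 4a₂ ≡ 1 (mod 4)`, `c₄ = b₂² − 24 b₄`; the formulae of
Silverman *AEC* III.1). [cite: SilvermanAEC2009, III.1 (b₂, b₄, c₄)] [cite: Kraus1989, Prop. 2] -/
theorem odd_c₄_of_odd_a₁ (h : Odd M.a₁) : ¬ (2 : ℤ) ∣ M.c₄ := by
  obtain ⟨x, hx⟩ := h
  obtain ⟨K, hK⟩ : ∃ K : ℤ, M.c₄ = 2 * K + 1 :=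
    ⟨8 * (x ^ 2 + x + M.a₂) ^ 2 + 4 * (x ^ 2 + x + M.a₂) - 12 * (2 * M.a₄ + (2 * x + 1) * M.a₃), by
      simp only [WeierstrassCurve.c₄, WeierstrassCurve.b₂, WeierstrassCurve.b₄, hx]; ring⟩
  omega

/-- `a₁` odd ⟹ `c₆ ≡ −1 (mod 4)` (`b₂ ≡ 1 (mod 4)`, `c₆ = −b₂³ + 36 b₂ b₄ − 216 b₆`).
[cite: Kraus1989, Prop. 2] -/
theorem exists_c₆_eq_of_odd_a₁ (h : Odd M.a₁) : ∃ m : ℤ, M.c₆ = 4 * m - 1 := by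
  obtain ⟨x, hx⟩ := h
  refine ⟨-16 * (x ^ 2 + x + M.a₂) ^ 3 - 12 * (x ^ 2 + x + M.a₂) ^ 2 - 3 * (x ^ 2 + x + M.a₂)
    + 9 * (4 * (x ^ 2 + x + M.a₂) + 1) * (2 * M.a₄ + (2 * x + 1) * M.a₃)
    - 54 * (M.a₃ ^ 2 + 4 * M.a₆), ?_⟩
  simp only [WeierstrassCurve.c₆, WeierstrassCurve.b₂, WeierstrassCurve.b₄, WeierstrassCurve.b₆, hx]
  ring

/-- `a₁` even ⟹ `16 ∣ c₄` (`4 ∣ b₂`, `2 ∣ b₄`). [cite: Kraus1989, Prop. 2] -/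
theorem sixteen_dvd_c₄_of_even_a₁ (h : Even M.a₁) : (16 : ℤ) ∣ M.c₄ := by
  obtain ⟨x, hx⟩ := h
  refine ⟨(x ^ 2 + M.a₂) ^ 2 - 3 * M.a₄ - 3 * x * M.a₃, ?_⟩
  simp only [WeierstrassCurve.c₄, WeierstrassCurve.b₂, WeierstrassCurve.b₄, hx]
  ring

/-- `a₁` even and `a₃` odd ⟹ `c₆ ≡ 8 (mod 32)` (`c₆ ≡ −216 a₃² (mod 32)`).
[cite: Kraus1989, Prop. 2] -/
theorem exists_c₆_eq_of_even_a₁_of_odd_a₃ (h₁ : Even M.a₁) (h₃ : Odd M.a₃) :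
    ∃ t : ℤ, M.c₆ = 32 * t + 8 := by
  obtain ⟨x, hx⟩ := h₁
  obtain ⟨y, hy⟩ := h₃
  refine ⟨-2 * (x ^ 2 + M.a₂) ^ 3 + 9 * (x ^ 2 + M.a₂) * (M.a₄ + x * (2 * y + 1))
    - 27 * (y ^ 2 + y + M.a₆) - 7, ?_⟩
  simp only [WeierstrassCurve.c₆, WeierstrassCurve.b₂, WeierstrassCurve.b₄, WeierstrassCurve.b₆,
    hx, hy]
  ring

/-- `a₁` even and `a₃` odd ⟹ `Δ` odd (`Δ ≡ −27 b₆² (mod 2)`, `b₆ = a₃² + 4a₆` odd; the formulae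
of Silverman *AEC* III.1). [cite: SilvermanAEC2009, III.1 (b₂, b₄, b₆, b₈, Δ)] -/
theorem odd_Δ_of_even_a₁_of_odd_a₃ (h₁ : Even M.a₁) (h₃ : Odd M.a₃) : ¬ (2 : ℤ) ∣ M.Δ := by
  obtain ⟨x, hx⟩ := h₁
  obtain ⟨y, hy⟩ := h₃
  obtain ⟨K, hK⟩ : ∃ K : ℤ, M.Δ = 2 * K - 27 :=
    ⟨-8 * (x ^ 2 + M.a₂) ^ 2 *
        ((x + x) ^ 2 * M.a₆ + 4 * M.a₂ * M.a₆ - (x + x) * (2 * y + 1) * M.a₄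
          + M.a₂ * (2 * y + 1) ^ 2 - M.a₄ ^ 2)
      - 32 * (M.a₄ + x * (2 * y + 1)) ^ 3
      - 27 * (8 * (y ^ 2 + y + M.a₆) ^ 2 + 4 * (y ^ 2 + y + M.a₆))
      + 36 * (x ^ 2 + M.a₂) * (M.a₄ + x * (2 * y + 1)) * (4 * (y ^ 2 + y + M.a₆) + 1), by
      simp only [WeierstrassCurve.Δ, WeierstrassCurve.b₂, WeierstrassCurve.b₄, WeierstrassCurve.b₆,
        WeierstrassCurve.b₈, hx, hy]
      ring⟩
  omega

/-- `a₁` and `a₃` even ⟹ `2 ∣ c₄` and `2 ∣ Δ` (so the equation, if minimal at `2`, is additive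
there; the formulae of Silverman *AEC* III.1 and VII.5 Prop. 5.1).
[cite: SilvermanAEC2009, III.1 (c₄, Δ) and VII.5 Prop. 5.1] -/
theorem two_dvd_c₄_and_two_dvd_Δ_of_even_a₁_of_even_a₃ (h₁ : Even M.a₁) (h₃ : Even M.a₃) :
    (2 : ℤ) ∣ M.c₄ ∧ (2 : ℤ) ∣ M.Δ := by
  obtain ⟨x, hx⟩ := h₁
  obtain ⟨y, hy⟩ := h₃
  constructor
  · refine ⟨8 * ((x ^ 2 + M.a₂) ^ 2 - 3 * M.a₄ - 3 * x * (y + y)), ?_⟩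
    simp only [WeierstrassCurve.c₄, WeierstrassCurve.b₂, WeierstrassCurve.b₄, hx, hy]
    ring
  · refine ⟨-8 * (x ^ 2 + M.a₂) ^ 2 *
        ((x + x) ^ 2 * M.a₆ + 4 * M.a₂ * M.a₆ - (x + x) * (y + y) * M.a₄ + M.a₂ * (y + y) ^ 2
          - M.a₄ ^ 2)
      - 32 * (M.a₄ + 2 * x * y) ^ 3 - 216 * (y ^ 2 + M.a₆) ^ 2
      + 144 * (x ^ 2 + M.a₂) * (M.a₄ + 2 * x * y) * (y ^ 2 + M.a₆), ?_⟩
    simp only [WeierstrassCurve.Δ, WeierstrassCurve.b₂, WeierstrassCurve.b₄, WeierstrassCurve.b₆,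
      WeierstrassCurve.b₈, hx, hy]
    ring

end Parity

end Literature.NumberTheory.EllipticCurves

namespace WeierstrassCurve

open IsLocalRing Literature.NumberTheory.EllipticCurves

/-- **At an odd place `v ∤ D`, the twisted equation `W^{(D)}` of a globally minimal `W` is minimal**
(`D ∈ ℤ`): over `ℚ_v` it is the twist by the `v`-UNIT `D` of the `v`-minimal equation `W ⊗ ℚ_v`
(`isMinimal_quadraticTwist`; Pal 2012, Prop. 2.5, "`u_ℓ = 1` if `ℓ` is an odd prime not dividing
`d`"). [cite: Pal2012, Prop. 2.5 (odd ℓ ∤ d)] [cite: SilvermanAEC2009, VII.1 Prop. 1.3] -/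
theorem isMinimalAt_quadraticTwist_intCast_of_odd_of_not_dvd (W : WeierstrassCurve ℚ)
    [W.IsGloballyMinimal] (v : HeightOneSpectrum (𝓞 ℚ)) (hv2 : (primesEquiv v : ℕ) ≠ 2) {D : ℤ}
    (hvD : ¬ ((primesEquiv v : ℕ) : ℤ) ∣ D) : (W.quadraticTwist (D : ℚ)).IsMinimalAt v := by
  haveI := Fact.mk (primesEquiv v).2
  have hℓp : (primesEquiv v : ℕ).Prime := (primesEquiv v).2
  have hℓ2 : ¬ ((primesEquiv v : ℕ) : ℤ) ∣ 2 := by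
    intro h
    exact hv2 ((Nat.prime_dvd_prime_iff_eq hℓp Nat.prime_two).mp (Int.natCast_dvd_natCast.mp h))
  have hu := isUnit_adicCompletionIntegers_intCast v hvD
  have h2 : IsUnit (2 : v.adicCompletionIntegers ℚ) := by
    have := isUnit_adicCompletionIntegers_intCast v hℓ2
    simpa using this
  haveI hX : (W.baseChange (v.adicCompletion ℚ)).IsMinimal (v.adicCompletionIntegers ℚ) :=
    IsGloballyMinimal.isMinimal v
  have htw : (W.quadraticTwist (D : ℚ)).baseChange (v.adicCompletion ℚ) =
      (W.baseChange (v.adicCompletion ℚ)).quadraticTwist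
        (algebraMap (v.adicCompletionIntegers ℚ) (v.adicCompletion ℚ) hu.unit) := by
    rw [baseChange, map_quadraticTwist, IsUnit.unit_spec, algebraMap_adicCompletionIntegers_intCast]
    rfl
  unfold IsMinimalAt
  rw [htw]
  exact isMinimal_quadraticTwist (v.adicCompletionIntegers ℚ) _ h2 hu.unit

/-! ### Minimality at `2` from the failure of Kraus's condition (discriminant form) -/

/-- **Minimality at `2` from the failure of Kraus's conditions for the descended invariants —
discriminant form.** As `isMinimal_of_kraus_fails` (Kraus 1989 Prop. 2; Silverman *AEC* VII.1),
but with the hypothesis `|Δ(X)|₂ > 2⁻²⁴` in place of `|c₄(X)|₂ > 2⁻⁸` to force `ord(u) = 1` for a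
descent `u`: an integral `C • X` with `|u| < 1` has `|Δ(C • X)| = |u|⁻¹²|Δ(X)| ≤ 1`. (Needed for
the twists of curves supersingular at `2`, where `2⁸ ∣ c₄`.) [cite: Kraus1989, Prop. 2]
[cite: SilvermanAEC2009, VII.1 (minimal equations) and III.1 Table 3.1] -/
theorem isMinimal_of_kraus_fails_of_valuation_Δ (v : HeightOneSpectrum (𝓞 ℚ))
    (hv : natGenerator v = 2) (Y : WeierstrassCurve (v.adicCompletion ℚ))
    [Y.IsIntegral (v.adicCompletionIntegers ℚ)]
    (hΔ : WithZero.exp (-24 : ℤ) < Valued.v Y.Δ)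
    (hK : ∀ w : v.adicCompletion ℚ, Valued.v w = 1 →
      ¬ ((Valued.v (Y.c₄ / (16 * w ^ 4)) ≤ WithZero.exp (-4 : ℤ) ∧
          (Valued.v (Y.c₆ / (64 * w ^ 6)) ≤ WithZero.exp (-5 : ℤ) ∨
            Valued.v (Y.c₆ / (64 * w ^ 6) - 8) ≤ WithZero.exp (-5 : ℤ))) ∨
        Valued.v (Y.c₆ / (64 * w ^ 6) + 1) ≤ WithZero.exp (-2 : ℤ))) :
    Y.IsMinimal (v.adicCompletionIntegers ℚ) := by
  have V2 := valued_two v hv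
  have h20 : (2 : v.adicCompletion ℚ) ≠ 0 := by
    intro h; rw [h, Valuation.map_zero] at V2; exact WithZero.coe_ne_zero V2.symm
  have hV1 : ∀ x : v.adicCompletion ℚ,
      x ∈ (algebraMap (v.adicCompletionIntegers ℚ) (v.adicCompletion ℚ)).range → Valued.v x ≤ 1 :=
    fun x hx ↦ (valued_le_one_iff_mem_range_adicCompletionIntegers v x).mpr hx
  rw [isMinimal_iff_of_le_one_iff (valued_le_one_iff_mem_range_adicCompletionIntegers v)]
  refine ⟨inferInstance, fun C hC ↦ ?_⟩
  haveI := hC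
  rw [variableChange_Δ, Valuation.map_mul, Valuation.map_pow]
  set U : WithZero (Multiplicative ℤ) := Valued.v (↑C.u⁻¹ : v.adicCompletion ℚ) with hU
  by_cases hU1 : U ≤ 1
  · exact mul_le_of_le_one_left zero_le (pow_le_one₀ zero_le hU1)
  exfalso
  replace hU1 : 1 < U := not_le.mp hU1
  have hU0 : U ≠ 0 := (Valuation.ne_zero_iff _).mpr (Units.ne_zero _)
  -- integrality of `Δ(C • Y)` forces `ord(u) = 1`
  have hc : Valued.v (C • Y).Δ ≤ 1 :=
    hV1 _ ⟨_, integralModel_Δ_eq (v.adicCompletionIntegers ℚ) (C • Y)⟩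
  rw [variableChange_Δ, Valuation.map_mul, Valuation.map_pow] at hc
  have hΔ0 : Valued.v Y.Δ ≠ 0 := (WithZero.exp_pos.trans hΔ).ne'
  have hUe : U = WithZero.exp (1 : ℤ) := by
    have hl1 : 0 < WithZero.log U := WithZero.lt_log_of_exp_lt (by rwa [WithZero.exp_zero])
    have h1 : -24 < WithZero.log (Valued.v Y.Δ) := WithZero.lt_log_of_exp_lt hΔ
    have h2 : 12 • WithZero.log U + WithZero.log (Valued.v Y.Δ) ≤ 0 := by
      rw [← WithZero.log_pow, ← WithZero.log_mul (pow_ne_zero _ hU0) hΔ0, ← WithZero.log_one]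
      exact (WithZero.log_le_log (mul_ne_zero (pow_ne_zero _ hU0) hΔ0) one_ne_zero).mpr hc
    have hlog : WithZero.log U = 1 := by
      simp only [nsmul_eq_mul, Nat.cast_ofNat] at h2
      omega
    rw [← WithZero.exp_log hU0, hlog]
  -- the unit `w = u / 2`
  set w : v.adicCompletion ℚ := (C.u : v.adicCompletion ℚ) / 2 with hw
  have hw1 : Valued.v w = 1 := by
    have hu : Valued.v ((C.u : v.adicCompletion ℚ)) = WithZero.exp (-1 : ℤ) := by
      have h1 : Valued.v ((C.u : v.adicCompletion ℚ)) * U = 1 := by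
        rw [hU, ← Valuation.map_mul, Units.mul_inv, Valuation.map_one]
      rw [hUe] at h1
      calc Valued.v ((C.u : v.adicCompletion ℚ))
          = Valued.v ((C.u : v.adicCompletion ℚ)) * WithZero.exp (1 : ℤ) * WithZero.exp (-1 : ℤ) := by
            rw [mul_assoc, withZero_exp_mul_exp]; simp
        _ = WithZero.exp (-1 : ℤ) := by rw [h1, one_mul]
    rw [hw, map_div₀, hu, V2, div_self (WithZero.coe_ne_zero)]
  have hu2w : (C.u : v.adicCompletion ℚ) = 2 * w := by rw [hw]; field_simp
  have hw0 : w ≠ 0 := by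
    intro h; rw [h, Valuation.map_zero] at hw1; exact zero_ne_one hw1
  have hinv4 : (↑C.u⁻¹ : v.adicCompletion ℚ) ^ 4 * Y.c₄ = Y.c₄ / (16 * w ^ 4) := by
    rw [Units.val_inv_eq_inv_val, hu2w, inv_pow, mul_pow, mul_comm, div_eq_mul_inv]
    norm_num
  have hinv6 : (↑C.u⁻¹ : v.adicCompletion ℚ) ^ 6 * Y.c₆ = Y.c₆ / (64 * w ^ 6) := by
    rw [Units.val_inv_eq_inv_val, hu2w, inv_pow, mul_pow, mul_comm, div_eq_mul_inv]
    norm_num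
  -- Kraus for the integral `C • Y`
  obtain ⟨i1, i2, i3, i4, i6⟩ := (isIntegral_iff_forall_mem_range (C • Y)).mp hC
  have hKr := kraus_two_of_integral v hv (C • Y) (hV1 _ i1) (hV1 _ i2) (hV1 _ i3) (hV1 _ i4)
    (hV1 _ i6)
  rw [variableChange_c₄, variableChange_c₆, hinv4, hinv6] at hKr
  exact hK w hw1 hKr

end WeierstrassCurve

namespace Literature.NumberTheory.EllipticCurves

/-! ### The twisted equation `W^{(4d)} = (0, d b₂, 0, 8d² b₄, 16d³ b₆)`, `d ∈ {−1, 2, −2}`, of a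
globally minimal `W` semistable at `2` is GLOBALLY MINIMAL in the cases `η = 1` -/

section MinimalAtTwo

variable (W : WeierstrassCurve ℚ) [W.IsGloballyMinimal]

/-- At a place `v` of `ℚ`, an integer divisible by the prime under `v` has valuation `< 1`.
[folklore] -/
private theorem valuation_intCast_lt_one_of_dvd (v : HeightOneSpectrum (𝓞 ℚ)) {n : ℤ}
    (h : (natGenerator v : ℤ) ∣ n) : v.valuation ℚ (n : ℚ) < 1 := by
  have h1 := Literature.NumberTheory.GaloisRepresentations.Rat.valuation_intCast_le v (n := n) (e := 1)
    (by rwa [pow_one])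
  have h2 : WithZero.exp (-((1 : ℕ) : ℤ)) < (1 : WithZero (Multiplicative ℤ)) := by
    rw [← WithZero.exp_zero]; exact WithZero.exp_lt_exp.mpr (by norm_num)
  exact lt_of_le_of_lt h1 h2

/-- **Semistable at `2` ⟹ `a₁` or `a₃` of the minimal equation is odd**: if both were even then
`2 ∣ c₄` and `2 ∣ Δ` (`two_dvd_c₄_and_two_dvd_Δ_of_even_a₁_of_even_a₃`), i.e. the minimal equation
would have neither `v(Δ) = 0` (good) nor `v(c₄) = 0` (multiplicative). Silverman *AEC* VII.5.1.
[cite: SilvermanAEC2009, VII.5 Prop. 5.1] -/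
theorem odd_a₁_or_odd_a₃_of_semistableAtTwo [W.IsElliptic]
    (hsemi : W.HasGoodReductionAtPrime 2 ∨ W.HasMultiplicativeReductionAtPrime 2) :
    Odd (integralModelInt W).a₁ ∨ Odd (integralModelInt W).a₃ := by
  set M : WeierstrassCurve ℤ := integralModelInt W with hM
  have hWM : M.map (Int.castRingHom ℚ) = W := map_integralModelInt W
  set v : HeightOneSpectrum (𝓞 ℚ) := (primesEquiv (R := 𝓞 ℚ)).symm ⟨2, Nat.prime_two⟩ with hv
  have hpv : primesEquiv v = ⟨2, Nat.prime_two⟩ := (primesEquiv (R := 𝓞 ℚ)).apply_symm_apply _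
  have hgen : natGenerator v = 2 := congrArg Subtype.val hpv
  have hgen2 : (natGenerator v : ℤ) = 2 := by exact_mod_cast hgen
  have hmin : W.IsMinimalAt v := IsGloballyMinimal.isMinimal v
  by_contra h
  rw [not_or, Int.not_odd_iff_even, Int.not_odd_iff_even] at h
  obtain ⟨hc₄, hΔ⟩ := two_dvd_c₄_and_two_dvd_Δ_of_even_a₁_of_even_a₃ M h.1 h.2
  have hvc₄ : v.valuation ℚ W.c₄ < 1 := by
    rw [← hWM, map_c₄, eq_intCast]
    exact valuation_intCast_lt_one_of_dvd v (by rw [hgen2]; exact hc₄)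
  have hvΔ : v.valuation ℚ W.Δ < 1 := by
    rw [← hWM, map_Δ, eq_intCast]
    exact valuation_intCast_lt_one_of_dvd v (by rw [hgen2]; exact hΔ)
  rcases hsemi with hg | hm
  · have hg' : W.HasGoodReductionAt v := by
      have h := W.hasGoodReductionAtPrime_iff_hasGoodReductionAt_ringOfIntegers v
      rw [hpv] at h
      exact h.mp hg
    rw [hasGoodReductionAt_iff_of_isMinimalAt hmin] at hg'
    exact hvΔ.ne hg'
  · have hm' : W.HasMultiplicativeReductionAt v := by
      have h := W.hasMultiplicativeReductionAtPrime_iff_hasMultiplicativeReductionAt_ringOfIntegers v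
      rw [hpv] at h
      exact h.mp hm
    rw [hasMultiplicativeReductionAt_iff_of_isMinimalAt hmin] at hm'
    exact hvc₄.ne hm'.2

/-- **Multiplicative at `2` ⟹ `a₁` of the minimal equation is odd** (`a₁` even gives `16 ∣ c₄`,
`sixteen_dvd_c₄_of_even_a₁`, contradicting `v(c₄) = 0`). Silverman *AEC* VII.5.1(b).
[cite: SilvermanAEC2009, VII.5 Prop. 5.1] -/
theorem odd_a₁_of_hasMultiplicativeReductionAtPrime_two [W.IsElliptic] (hm : W.HasMultiplicativeReductionAtPrime 2) :
    Odd (integralModelInt W).a₁ := by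
  set M : WeierstrassCurve ℤ := integralModelInt W with hM
  have hWM : M.map (Int.castRingHom ℚ) = W := map_integralModelInt W
  set v : HeightOneSpectrum (𝓞 ℚ) := (primesEquiv (R := 𝓞 ℚ)).symm ⟨2, Nat.prime_two⟩ with hv
  have hpv : primesEquiv v = ⟨2, Nat.prime_two⟩ := (primesEquiv (R := 𝓞 ℚ)).apply_symm_apply _
  have hgen : natGenerator v = 2 := congrArg Subtype.val hpv
  have hgen2 : (natGenerator v : ℤ) = 2 := by exact_mod_cast hgen
  have hmin : W.IsMinimalAt v := IsGloballyMinimal.isMinimal v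
  by_contra h
  rw [Int.not_odd_iff_even] at h
  have hc₄ : (2 : ℤ) ∣ M.c₄ := (show (2 : ℤ) ∣ 16 by norm_num).trans (sixteen_dvd_c₄_of_even_a₁ M h)
  have hvc₄ : v.valuation ℚ W.c₄ < 1 := by
    rw [← hWM, map_c₄, eq_intCast]
    exact valuation_intCast_lt_one_of_dvd v (by rw [hgen2]; exact hc₄)
  have hm' : W.HasMultiplicativeReductionAt v := by
    have h := W.hasMultiplicativeReductionAtPrime_iff_hasMultiplicativeReductionAt_ringOfIntegers v
    rw [hpv] at h
    exact h.mp hm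
  rw [hasMultiplicativeReductionAt_iff_of_isMinimalAt hmin] at hm'
  exact hvc₄.ne hm'.2

/-- The twisted equation `W^{(4d)} = (0, d b₂, 0, 8d² b₄, 16d³ b₆)` (`d ∈ ℤ`) of a globally
minimal `W` is integral at every place (the model `y² = x³ + b₂ d x² + 8 b₄ d² x + 16 b₆ d³` of the
twist `E_d`, Pal 2012 display (2.2)/Prop. 2.4; Silverman *AEC* X.5 Cor. 5.4).
[cite: Pal2012, Prop. 2.4] [cite: SilvermanAEC2009, X.5 Cor. 5.4 and III.1 Table 3.1] -/
theorem isIntegralAt_quadraticTwist_four_mul (d : ℤ) (v : HeightOneSpectrum (𝓞 ℚ)) :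
    (W.quadraticTwist (4 * (d : ℚ))).IsIntegralAt v := by
  set M : WeierstrassCurve ℤ := integralModelInt W with hM
  have hWM : M.map (Int.castRingHom ℚ) = W := map_integralModelInt W
  have hb₂ : W.b₂ = (M.b₂ : ℚ) := by rw [← hWM, map_b₂, eq_intCast]
  have hb₄ : W.b₄ = (M.b₄ : ℚ) := by rw [← hWM, map_b₄, eq_intCast]
  have hb₆ : W.b₆ = (M.b₆ : ℚ) := by rw [← hWM, map_b₆, eq_intCast]
  refine (W.quadraticTwist (4 * (d : ℚ))).isIntegralAt_of_valuation_le_one v ?_ ?_ ?_ ?_ ?_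
  · rw [quadraticTwist_a₁, map_zero]; exact zero_le_one
  · rw [quadraticTwist_a₂, hb₂, show 4 * (d : ℚ) * (M.b₂ : ℚ) / 4 = ((d * M.b₂ : ℤ) : ℚ) by
      push_cast; ring]
    exact valuation_ringOfIntegers_intCast_le_one v _
  · rw [quadraticTwist_a₃, map_zero]; exact zero_le_one
  · rw [quadraticTwist_a₄, hb₄, show (4 * (d : ℚ)) ^ 2 * (M.b₄ : ℚ) / 2 = ((8 * d ^ 2 * M.b₄ : ℤ) : ℚ) by
      push_cast; ring]
    exact valuation_ringOfIntegers_intCast_le_one v _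
  · rw [quadraticTwist_a₆, hb₆, show (4 * (d : ℚ)) ^ 3 * (M.b₆ : ℚ) / 4 = ((16 * d ^ 3 * M.b₆ : ℤ) : ℚ) by
      push_cast; ring]
    exact valuation_ringOfIntegers_intCast_le_one v _

/-- The twisted equation `W^{(4d)}` of a globally minimal `W` is minimal at every ODD place when
`d ∈ {−1, 2, −2}` (a unit twist of a minimal equation, `isMinimal_quadraticTwist`).
[cite: Pal2012, Prop. 2.5 (odd ℓ ∤ d)] [cite: SilvermanAEC2009, VII.1 Prop. 1.3] -/
theorem isMinimalAt_quadraticTwist_four_mul_of_odd_place {d : ℤ} (hd : d = -1 ∨ d = 2 ∨ d = -2)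
    (v : HeightOneSpectrum (𝓞 ℚ)) (hv2 : (primesEquiv v : ℕ) ≠ 2) :
    (W.quadraticTwist (4 * (d : ℚ))).IsMinimalAt v := by
  have hℓp : (primesEquiv v : ℕ).Prime := (primesEquiv v).2
  have hℓ2 : ¬ ((primesEquiv v : ℕ) : ℤ) ∣ 2 := fun h ↦
    hv2 ((Nat.prime_dvd_prime_iff_eq hℓp Nat.prime_two).mp (Int.natCast_dvd_natCast.mp h))
  have hprime : Prime ((primesEquiv v : ℕ) : ℤ) := Nat.prime_iff_prime_int.mp hℓp
  have h4d : ¬ ((primesEquiv v : ℕ) : ℤ) ∣ 4 * d := by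
    intro h
    rcases hprime.dvd_or_dvd h with h4 | hd'
    · exact hℓ2 ((hprime.dvd_or_dvd (show ((primesEquiv v : ℕ) : ℤ) ∣ 2 * 2 by norm_num at h4 ⊢; exact h4)).elim id id)
    · rcases hd with rfl | rfl | rfl
      · exact hℓp.one_lt.ne' (by exact_mod_cast Int.eq_one_of_dvd_one (by positivity) (dvd_neg.mp hd'))
      · exact hℓ2 hd'
      · exact hℓ2 (dvd_neg.mp hd')
  have h := isMinimalAt_quadraticTwist_intCast_of_odd_of_not_dvd W v hv2 h4d
  push_cast at h
  exact h

variable {W}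

/-- **Minimality at `2`, case `a₁` odd** (`W` good ordinary or multiplicative at `2`;
`d ∈ {−1, 2, −2}`): the equation `W^{(4d)}` has `c₄ = 16d²c₄(W)`, `c₆ = 64d³c₆(W)` with `c₄(W)`
odd and `c₆(W) ≡ −1 (mod 4)`; the only possible descent `u = 2w` (`|c₄| > 2⁻⁸`) would give the
invariants `c₄' = d²c₄(W)/w⁴` (`|c₄'| ≥ 2⁻²`, so `16 ∤ c₄'`) and `c₆' + 1 = (d³c₆(W) + w⁶)/w⁶` of
valuation `2⁻¹` (`d = −1`: `w⁶ − c₆(W) = (w⁶ − 1) + 2(1 − 2m)`) resp. `1` (`d = ±2`), violating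
Kraus's necessary condition `kraus_two_of_integral`. So the equation is minimal at `2`
(`isMinimal_of_kraus_fails`): this is the case "`2`-adic signature of `E` is `0,0,c`" of
Connell's proposition as printed by Pal 2012, Prop. 2.4 (`p = 2`: `d ≡ 3 (mod 4)` ⟹
`v₂(Δ') = v₂(Δ) + 12`; `d ≡ 2 (mod 4)` ⟹ `v₂(Δ') = v₂(Δ) + 18`), and Stevens' "application of
Tate's algorithm" giving `η = 1`. [cite: Pal2012, Prop. 2.4 (Connell), case p = 2 (arXiv p. 4)]
[cite: Kraus1989, Prop. 2] [cite: Stevens1989, Lemma (5.2) p. 96 (sketch of proof)]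
[cite: SilvermanAEC2009, VII.1] -/
theorem isMinimalAt_two_quadraticTwist_four_mul_of_odd_a₁ {d : ℤ} (hd : d = -1 ∨ d = 2 ∨ d = -2)
    (ha₁ : Odd (integralModelInt W).a₁) (v : HeightOneSpectrum (𝓞 ℚ)) (hv : (primesEquiv v : ℕ) = 2) :
    (W.quadraticTwist (4 * (d : ℚ))).IsMinimalAt v := by
  set M : WeierstrassCurve ℤ := integralModelInt W with hM
  have hWM : M.map (Int.castRingHom ℚ) = W := map_integralModelInt W
  have hgen : natGenerator v = 2 := hv
  have hWc₄ : W.c₄ = (M.c₄ : ℚ) := by rw [← hWM, map_c₄, eq_intCast]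
  have hWc₆ : W.c₆ = (M.c₆ : ℚ) := by rw [← hWM, map_c₆, eq_intCast]
  obtain ⟨m, hm⟩ := exists_c₆_eq_of_odd_a₁ M ha₁
  have hc₄odd := odd_c₄_of_odd_a₁ M ha₁
  set T := W.quadraticTwist (4 * (d : ℚ)) with hT
  set X := T.baseChange (v.adicCompletion ℚ) with hX
  haveI hXint : X.IsIntegral (v.adicCompletionIntegers ℚ) := isIntegralAt_quadraticTwist_four_mul W d v
  set D : v.adicCompletion ℚ := algebraMap ℚ (v.adicCompletion ℚ) (d : ℚ) with hD
  set C4 : v.adicCompletion ℚ := algebraMap ℚ (v.adicCompletion ℚ) (M.c₄ : ℚ) with hC4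
  set C6 : v.adicCompletion ℚ := algebraMap ℚ (v.adicCompletion ℚ) (M.c₆ : ℚ) with hC6
  have hXc₄ : X.c₄ = 16 * D ^ 2 * C4 := by
    rw [hX, WeierstrassCurve.baseChange, map_c₄, hT, quadraticTwist_c₄, hWc₄, map_mul, map_pow,
      map_mul, map_ofNat]
    ring
  have hXc₆ : X.c₆ = 64 * D ^ 3 * C6 := by
    rw [hX, WeierstrassCurve.baseChange, map_c₆, hT, quadraticTwist_c₆, hWc₆, map_mul, map_pow,
      map_mul, map_ofNat]
    ring
  -- valuations
  have V2 := valued_two v hgen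
  have h20 : (2 : v.adicCompletion ℚ) ≠ 0 := by
    intro h; rw [h, Valuation.map_zero] at V2; exact WithZero.coe_ne_zero V2.symm
  have V16 : Valued.v (16 : v.adicCompletion ℚ) = WithZero.exp (-4 : ℤ) := by
    rw [show (16 : v.adicCompletion ℚ) = 2 ^ 4 by norm_num, Valuation.map_pow, V2, ← WithZero.exp_nsmul]; norm_num
  have V64 : Valued.v (64 : v.adicCompletion ℚ) = WithZero.exp (-6 : ℤ) := by
    rw [show (64 : v.adicCompletion ℚ) = 2 ^ 6 by norm_num, Valuation.map_pow, V2, ← WithZero.exp_nsmul]; norm_num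
  have h16 : (16 : v.adicCompletion ℚ) ≠ 0 := by rw [show (16 : v.adicCompletion ℚ) = 2 ^ 4 by norm_num]; exact pow_ne_zero _ h20
  have h64 : (64 : v.adicCompletion ℚ) ≠ 0 := by rw [show (64 : v.adicCompletion ℚ) = 2 ^ 6 by norm_num]; exact pow_ne_zero _ h20
  have VC4 : Valued.v C4 = 1 := valued_intCast_eq_one_of_odd v hgen hc₄odd
  have VC6le : Valued.v C6 ≤ 1 := by
    rw [hC6, WeierstrassCurve.valued_algebraMap_adicCompletion]
    exact valuation_ringOfIntegers_intCast_le_one v _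
  -- `1 - C6 = 2 (1 - 2m)` has valuation `exp (-1)`
  have V1C6 : Valued.v (1 - C6) = WithZero.exp (-1 : ℤ) := by
    have e : (1 - C6) = 2 * algebraMap ℚ (v.adicCompletion ℚ) ((1 - 2 * m : ℤ) : ℚ) := by
      rw [hC6, hm, show (2 : v.adicCompletion ℚ) = algebraMap ℚ (v.adicCompletion ℚ) ((2 : ℤ) : ℚ) by simp,
        show (1 : v.adicCompletion ℚ) = algebraMap ℚ (v.adicCompletion ℚ) ((1 : ℤ) : ℚ) by simp, ← map_mul, ← map_sub]
      congr 1; push_cast; ring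
    rw [e, Valuation.map_mul, V2, valued_intCast_eq_one_of_odd v hgen (by omega), mul_one]
  -- the valuation of `d`
  have VD : (d = -1 ∧ D = -1) ∨ ((d = 2 ∨ d = -2) ∧ Valued.v D = WithZero.exp (-1 : ℤ)) := by
    rcases hd with rfl | rfl | rfl
    · left; exact ⟨rfl, by rw [hD]; simp⟩
    · right; refine ⟨Or.inl rfl, ?_⟩
      rw [hD, show ((2 : ℤ) : ℚ) = 2 by norm_num, map_ofNat, V2]
    · right; refine ⟨Or.inr rfl, ?_⟩
      rw [hD, show ((-2 : ℤ) : ℚ) = -2 by norm_num, map_neg, map_ofNat, Valuation.map_neg, V2]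
  -- `|c₄(X)| > 2⁻⁸`
  have hc₄X : WithZero.exp (-8 : ℤ) < Valued.v X.c₄ := by
    rw [hXc₄, Valuation.map_mul, Valuation.map_mul, V16, Valuation.map_pow, VC4, mul_one]
    rcases VD with ⟨-, hD1⟩ | ⟨-, hDv⟩
    · rw [hD1, Valuation.map_neg, Valuation.map_one, one_pow, mul_one]
      exact WithZero.exp_lt_exp.mpr (by norm_num)
    · rw [hDv, ← WithZero.exp_nsmul, withZero_exp_mul_exp]
      exact WithZero.exp_lt_exp.mpr (by norm_num)
  refine isMinimal_of_kraus_fails v hgen X hc₄X fun w hw hKr ↦ ?_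
  have hw0 : w ≠ 0 := by
    intro h; rw [h, Valuation.map_zero] at hw; exact zero_ne_one hw
  have hw6 := valued_pow_six_sub_one_le v hgen hw
  -- the descended invariants
  have e4 : X.c₄ / (16 * w ^ 4) = D ^ 2 * C4 / w ^ 4 := by
    rw [hXc₄]; field_simp
  have e6 : X.c₆ / (64 * w ^ 6) = D ^ 3 * C6 / w ^ 6 := by
    rw [hXc₆]; field_simp
  rcases hKr with ⟨h4, -⟩ | h6
  · -- `16 ∤ c₄'`: `|c₄'| = |d|² ≥ 2⁻²`
    rw [e4, map_div₀, Valuation.map_mul, Valuation.map_pow, Valuation.map_pow, hw, one_pow, div_one,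
      VC4, mul_one] at h4
    rcases VD with ⟨-, hD1⟩ | ⟨-, hDv⟩
    · rw [hD1, Valuation.map_neg, Valuation.map_one, one_pow, ← WithZero.exp_zero,
        WithZero.exp_le_exp] at h4
      omega
    · rw [hDv, ← WithZero.exp_nsmul, WithZero.exp_le_exp] at h4
      simp at h4
  · -- `c₆' + 1` is not `≡ 0 (mod 4)`
    rw [e6] at h6
    rcases VD with ⟨-, hD1⟩ | ⟨-, hDv⟩
    · -- `d = -1`: `c₆' + 1 = ((1 - C6) + (w⁶ - 1)) / w⁶`, valuation `exp (-1)`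
      have e : D ^ 3 * C6 / w ^ 6 + 1 = ((1 - C6) + (w ^ 6 - 1)) / w ^ 6 := by
        rw [hD1]; field_simp; ring
      have hlt : Valued.v (w ^ 6 - 1) < Valued.v (1 - C6) := by
        rw [V1C6]; exact lt_of_le_of_lt hw6 (WithZero.exp_lt_exp.mpr (by norm_num))
      rw [e, map_div₀, Valuation.map_pow, hw, one_pow, div_one, Valuation.map_add_eq_of_lt_left _ hlt,
        V1C6, WithZero.exp_le_exp] at h6
      omega
    · -- `d = ±2`: `|d³ c₆ / w⁶| ≤ 2⁻³ < 1`, so `c₆' + 1` is a unit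
      have hlt : Valued.v (D ^ 3 * C6 / w ^ 6) < Valued.v (1 : v.adicCompletion ℚ) := by
        rw [map_div₀, Valuation.map_mul, Valuation.map_pow, Valuation.map_pow, hw, one_pow, div_one,
          hDv, Valuation.map_one, ← WithZero.exp_nsmul]
        calc WithZero.exp ((3 : ℕ) • (-1 : ℤ)) * Valued.v C6 ≤ WithZero.exp ((3 : ℕ) • (-1 : ℤ)) * 1 :=
              mul_le_mul_right VC6le _
          _ < 1 := by rw [mul_one, ← WithZero.exp_zero]; exact WithZero.exp_lt_exp.mpr (by norm_num)
      rw [add_comm, Valuation.map_add_eq_of_lt_left _ hlt, Valuation.map_one, ← WithZero.exp_zero,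
        WithZero.exp_le_exp] at h6
      omega

/-- **Minimality at `2`, case `a₁` even, `a₃` odd, `d = −1`** (`W` good supersingular at `2`,
twist by `χ₋₄`): here `16 ∣ c₄(W)`, `c₆(W) ≡ 8 (mod 32)`, `Δ(W)` odd, so `|Δ(W^{(−4)})| = 2⁻¹²`
and a descent has `u = 2w`; its invariants `c₄' = c₄(W)/w⁴`, `c₆' = −c₆(W)/w⁶` satisfy
`|c₆'| = 2⁻³` (not `≤ 2⁻⁵`), `|c₆' − 8| = |8((4t + 1) + w⁶)| = 2⁻⁴` (not `≤ 2⁻⁵`) and `c₆' + 1` a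
unit (not `≡ 0 mod 4`): Kraus's necessary condition fails, so the equation is minimal at `2`
(`isMinimal_of_kraus_fails_of_valuation_Δ`): the case "`2`-adic signature `a,3,0` (`4 ≤ a ≤ ∞`),
`d ≡ 3 (mod 4)` ⟹ `v₂(Δ') = v₂(Δ) + 12`" of Connell's proposition (Pal 2012, Prop. 2.4), and
Stevens' `η = 1` for conductor `4`. [cite: Pal2012, Prop. 2.4 (Connell), case p = 2 (arXiv p. 4)]
[cite: Kraus1989, Prop. 2] [cite: Stevens1989, Lemma (5.2) p. 96] [cite: SilvermanAEC2009, VII.1] -/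
theorem isMinimalAt_two_quadraticTwist_neg_four_of_even_a₁_of_odd_a₃
    (ha₁ : Even (integralModelInt W).a₁) (ha₃ : Odd (integralModelInt W).a₃)
    (v : HeightOneSpectrum (𝓞 ℚ)) (hv : (primesEquiv v : ℕ) = 2) :
    (W.quadraticTwist (4 * ((-1 : ℤ) : ℚ))).IsMinimalAt v := by
  set M : WeierstrassCurve ℤ := integralModelInt W with hM
  have hWM : M.map (Int.castRingHom ℚ) = W := map_integralModelInt W
  have hgen : natGenerator v = 2 := hv
  have hWc₄ : W.c₄ = (M.c₄ : ℚ) := by rw [← hWM, map_c₄, eq_intCast]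
  have hWc₆ : W.c₆ = (M.c₆ : ℚ) := by rw [← hWM, map_c₆, eq_intCast]
  have hWΔ : W.Δ = (M.Δ : ℚ) := by rw [← hWM, map_Δ, eq_intCast]
  obtain ⟨t, ht⟩ := exists_c₆_eq_of_even_a₁_of_odd_a₃ M ha₁ ha₃
  have hc₄16 := sixteen_dvd_c₄_of_even_a₁ M ha₁
  have hΔodd := odd_Δ_of_even_a₁_of_odd_a₃ M ha₁ ha₃
  set T := W.quadraticTwist (4 * ((-1 : ℤ) : ℚ)) with hT
  set X := T.baseChange (v.adicCompletion ℚ) with hX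
  haveI hXint : X.IsIntegral (v.adicCompletionIntegers ℚ) :=
    isIntegralAt_quadraticTwist_four_mul W (-1) v
  set C4 : v.adicCompletion ℚ := algebraMap ℚ (v.adicCompletion ℚ) (M.c₄ : ℚ) with hC4
  set C6 : v.adicCompletion ℚ := algebraMap ℚ (v.adicCompletion ℚ) (M.c₆ : ℚ) with hC6
  set CΔ : v.adicCompletion ℚ := algebraMap ℚ (v.adicCompletion ℚ) (M.Δ : ℚ) with hCΔ
  have hXc₄ : X.c₄ = 16 * C4 := by
    rw [hX, WeierstrassCurve.baseChange, map_c₄, hT, quadraticTwist_c₄, hWc₄, map_mul, map_pow,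
      map_mul, map_ofNat, map_intCast]
    push_cast; ring
  have hXc₆ : X.c₆ = -(64 * C6) := by
    rw [hX, WeierstrassCurve.baseChange, map_c₆, hT, quadraticTwist_c₆, hWc₆, map_mul, map_pow,
      map_mul, map_ofNat, map_intCast]
    push_cast; ring
  have hXΔ : X.Δ = 4096 * CΔ := by
    rw [hX, WeierstrassCurve.baseChange, map_Δ, hT, quadraticTwist_Δ, hWΔ, map_mul, map_pow,
      map_mul, map_ofNat, map_intCast]
    push_cast; ring
  -- valuations
  have V2 := valued_two v hgen
  have h20 : (2 : v.adicCompletion ℚ) ≠ 0 := by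
    intro h; rw [h, Valuation.map_zero] at V2; exact WithZero.coe_ne_zero V2.symm
  have V8 : Valued.v (8 : v.adicCompletion ℚ) = WithZero.exp (-3 : ℤ) := by
    rw [show (8 : v.adicCompletion ℚ) = 2 ^ 3 by norm_num, Valuation.map_pow, V2, ← WithZero.exp_nsmul]; norm_num
  have V4096 : Valued.v (4096 : v.adicCompletion ℚ) = WithZero.exp (-12 : ℤ) := by
    rw [show (4096 : v.adicCompletion ℚ) = 2 ^ 12 by norm_num, Valuation.map_pow, V2, ← WithZero.exp_nsmul]; norm_num
  have h64 : (64 : v.adicCompletion ℚ) ≠ 0 := by rw [show (64 : v.adicCompletion ℚ) = 2 ^ 6 by norm_num]; exact pow_ne_zero _ h20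
  have h16 : (16 : v.adicCompletion ℚ) ≠ 0 := by rw [show (16 : v.adicCompletion ℚ) = 2 ^ 4 by norm_num]; exact pow_ne_zero _ h20
  have VCΔ : Valued.v CΔ = 1 := valued_intCast_eq_one_of_odd v hgen hΔodd
  -- `C6 = 8 (4t + 1)`
  set S : v.adicCompletion ℚ := algebraMap ℚ (v.adicCompletion ℚ) ((4 * t + 1 : ℤ) : ℚ) with hS
  have hC6S : C6 = 8 * S := by
    rw [hC6, hS, ht, show (8 : v.adicCompletion ℚ) = algebraMap ℚ (v.adicCompletion ℚ) ((8 : ℤ) : ℚ) by simp, ← map_mul]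
    congr 1; push_cast; ring
  have VS : Valued.v S = 1 := valued_intCast_eq_one_of_odd v hgen (by omega)
  have VC6 : Valued.v C6 = WithZero.exp (-3 : ℤ) := by rw [hC6S, Valuation.map_mul, V8, VS, mul_one]
  -- `S + w⁶ = (S + 1) + (w⁶ - 1)` has valuation `exp (-1)` for a unit `w`
  have VS1 : Valued.v (S + 1) = WithZero.exp (-1 : ℤ) := by
    have e : S + 1 = 2 * algebraMap ℚ (v.adicCompletion ℚ) ((2 * t + 1 : ℤ) : ℚ) := by
      rw [hS, show (2 : v.adicCompletion ℚ) = algebraMap ℚ (v.adicCompletion ℚ) ((2 : ℤ) : ℚ) by simp,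
        show (1 : v.adicCompletion ℚ) = algebraMap ℚ (v.adicCompletion ℚ) ((1 : ℤ) : ℚ) by simp, ← map_mul, ← map_add]
      congr 1; push_cast; ring
    rw [e, Valuation.map_mul, V2, valued_intCast_eq_one_of_odd v hgen (by omega), mul_one]
  -- `|Δ(X)| = 2⁻¹² > 2⁻²⁴`
  have hΔX : WithZero.exp (-24 : ℤ) < Valued.v X.Δ := by
    rw [hXΔ, Valuation.map_mul, V4096, VCΔ, mul_one]
    exact WithZero.exp_lt_exp.mpr (by norm_num)
  refine isMinimal_of_kraus_fails_of_valuation_Δ v hgen X hΔX fun w hw hKr ↦ ?_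
  have hw0 : w ≠ 0 := by
    intro h; rw [h, Valuation.map_zero] at hw; exact zero_ne_one hw
  have hw6 := valued_pow_six_sub_one_le v hgen hw
  have Vw6 : Valued.v (w ^ 6) = 1 := by rw [Valuation.map_pow, hw, one_pow]
  have e6 : X.c₆ / (64 * w ^ 6) = -(C6 / w ^ 6) := by
    rw [hXc₆]; field_simp
  have VC6w : Valued.v (C6 / w ^ 6) = WithZero.exp (-3 : ℤ) := by
    rw [map_div₀, Vw6, div_one, VC6]
  rcases hKr with ⟨-, h5 | h5⟩ | h6
  · -- `|c₆'| = 2⁻³`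
    rw [e6, Valuation.map_neg, VC6w, WithZero.exp_le_exp] at h5
    omega
  · -- `|c₆' - 8| = |8 (S + w⁶)| / 1 = 2⁻⁴`
    have e : -(C6 / w ^ 6) - 8 = -(8 * ((S + 1) + (w ^ 6 - 1)) / w ^ 6) := by
      rw [hC6S]; field_simp; ring
    have hlt : Valued.v (w ^ 6 - 1) < Valued.v (S + 1) := by
      rw [VS1]; exact lt_of_le_of_lt hw6 (WithZero.exp_lt_exp.mpr (by norm_num))
    rw [e6, e, Valuation.map_neg, map_div₀, Vw6, div_one, Valuation.map_mul, V8,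
      Valuation.map_add_eq_of_lt_left _ hlt, VS1, withZero_exp_mul_exp, WithZero.exp_le_exp] at h5
    norm_num at h5
  · -- `c₆' + 1` is a unit
    have hlt : Valued.v (-(C6 / w ^ 6)) < Valued.v (1 : v.adicCompletion ℚ) := by
      rw [Valuation.map_neg, VC6w, Valuation.map_one, ← WithZero.exp_zero]
      exact WithZero.exp_lt_exp.mpr (by norm_num)
    rw [e6, add_comm, Valuation.map_add_eq_of_lt_left _ hlt, Valuation.map_one, ← WithZero.exp_zero,
      WithZero.exp_le_exp] at h6
    omega

variable (W)

/-- The twisted equation `W^{(4d)} = (0, d b₂, 0, 8d² b₄, 16d³ b₆)` (`d ∈ ℤ`) of a globally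
minimal `W` has coefficients in `𝓞 ℚ` (Pal 2012 display (2.2)/Prop. 2.4).
[cite: Pal2012, Prop. 2.4] [cite: SilvermanAEC2009, X.5 Cor. 5.4 and III.1 Table 3.1] -/
theorem isIntegral_ringOfIntegers_quadraticTwist_four_mul (d : ℤ) :
    (W.quadraticTwist (4 * (d : ℚ))).IsIntegral (𝓞 ℚ) := by
  set M : WeierstrassCurve ℤ := integralModelInt W with hM
  have hWM : M.map (Int.castRingHom ℚ) = W := map_integralModelInt W
  have hb₂ : W.b₂ = (M.b₂ : ℚ) := by rw [← hWM, map_b₂, eq_intCast]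
  have hb₄ : W.b₄ = (M.b₄ : ℚ) := by rw [← hWM, map_b₄, eq_intCast]
  have hb₆ : W.b₆ = (M.b₆ : ℚ) := by rw [← hWM, map_b₆, eq_intCast]
  refine ⟨⟨⟨0, ((d * M.b₂ : ℤ) : 𝓞 ℚ), 0, ((8 * d ^ 2 * M.b₄ : ℤ) : 𝓞 ℚ),
    ((16 * d ^ 3 * M.b₆ : ℤ) : 𝓞 ℚ)⟩, ?_⟩⟩
  ext
  · simp [WeierstrassCurve.baseChange]
  · simp only [WeierstrassCurve.baseChange, map_a₂, quadraticTwist_a₂, map_intCast, hb₂]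
    push_cast; ring
  · simp [WeierstrassCurve.baseChange]
  · simp only [WeierstrassCurve.baseChange, map_a₄, quadraticTwist_a₄, map_intCast, hb₄]
    push_cast; ring
  · simp only [WeierstrassCurve.baseChange, map_a₆, quadraticTwist_a₆, map_intCast, hb₆]
    push_cast; ring

/-- **`W^{(4d)}` is GLOBALLY MINIMAL when `a₁(W)` is odd** (`W` globally minimal, good ordinary or
multiplicative at `2`; `d ∈ {−1, 2, −2}`): minimal at the odd places
(`isMinimalAt_quadraticTwist_four_mul_of_odd_place`) and at `2`
(`isMinimalAt_two_quadraticTwist_four_mul_of_odd_a₁`). Connell / Pal 2012 Prop. 2.4 (signature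
`0,0,c`); Stevens 1989 Lemma (5.2), `η = 1`. [cite: Pal2012, Prop. 2.4 (Connell), case p = 2]
[cite: Stevens1989, Lemma (5.2) p. 96] [cite: Kraus1989, Prop. 2] -/
theorem isGloballyMinimal_quadraticTwist_four_mul_of_odd_a₁ {d : ℤ} (hd : d = -1 ∨ d = 2 ∨ d = -2)
    (ha₁ : Odd (integralModelInt W).a₁) : (W.quadraticTwist (4 * (d : ℚ))).IsGloballyMinimal :=
  ⟨isIntegral_ringOfIntegers_quadraticTwist_four_mul W d, fun v ↦ by
    by_cases hv : (primesEquiv v : ℕ) = 2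
    · exact isMinimalAt_two_quadraticTwist_four_mul_of_odd_a₁ hd ha₁ v hv
    · exact isMinimalAt_quadraticTwist_four_mul_of_odd_place W hd v hv⟩

/-- **`W^{(−4)}` is GLOBALLY MINIMAL when `W` is semistable at `2`** (`W` globally minimal, good
or multiplicative at `2`; twist by `χ₋₄`): by `odd_a₁_or_odd_a₃_of_semistableAtTwo` either `a₁` is
odd (`isGloballyMinimal_quadraticTwist_four_mul_of_odd_a₁`) or `a₁` is even and `a₃` odd
(`isMinimalAt_two_quadraticTwist_neg_four_of_even_a₁_of_odd_a₃`). Connell / Pal 2012 Prop. 2.4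
(`d ≡ 3 (mod 4)`, signatures `0,0,c` and `a,3,0`); Stevens 1989 Lemma (5.2): `η = 1` whenever the
conductor of `ψ` is `4`. [cite: Pal2012, Prop. 2.4 (Connell), case p = 2]
[cite: Stevens1989, Lemma (5.2) p. 96] [cite: Kraus1989, Prop. 2] -/
theorem isGloballyMinimal_quadraticTwist_neg_four_of_semistable [W.IsElliptic]
    (hsemi : W.HasGoodReductionAtPrime 2 ∨ W.HasMultiplicativeReductionAtPrime 2) :
    (W.quadraticTwist (4 * ((-1 : ℤ) : ℚ))).IsGloballyMinimal := by
  rcases Int.even_or_odd (integralModelInt W).a₁ with he | ho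
  · have ha₃ : Odd (integralModelInt W).a₃ :=
      (odd_a₁_or_odd_a₃_of_semistableAtTwo W hsemi).resolve_left (Int.not_odd_iff_even.mpr he)
    exact ⟨isIntegral_ringOfIntegers_quadraticTwist_four_mul W (-1), fun v ↦ by
      by_cases hv : (primesEquiv v : ℕ) = 2
      · exact isMinimalAt_two_quadraticTwist_neg_four_of_even_a₁_of_odd_a₃ he ha₃ v hv
      · exact isMinimalAt_quadraticTwist_four_mul_of_odd_place W (Or.inl rfl) v hv⟩
  · exact isGloballyMinimal_quadraticTwist_four_mul_of_odd_a₁ W (Or.inl rfl) ho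

/-- **`W^{(4d)}`, `d ∈ {−1, 2, −2}`, is GLOBALLY MINIMAL for `W` semistable at `2`, provided
`d = −1` or `W` is multiplicative at `2`** — the `η = 1` cases of Stevens 1989 Lemma (5.2) that do
not need the ordinary/supersingular distinction (the remaining case `η = 1`, `d = ±2` with `W` good
ORDINARY at `2`, is `isGloballyMinimal_quadraticTwist_four_mul_of_odd_a₁`; for `d = ±2` and `W`
good SUPERSINGULAR at `2` Stevens' `η` is `2` and the equation is not minimal at `2`: Pal 2012
Prop. 2.4, `d ≡ 2 (mod 4)`, "`v₂(c₆(E)) = 3` ⟹ `v₂(Δ') = v₂(Δ) + 6`").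
[cite: Pal2012, Prop. 2.4 (Connell), case p = 2] [cite: Stevens1989, Lemma (5.2) p. 96]
[cite: Kraus1989, Prop. 2] -/
theorem isGloballyMinimal_quadraticTwist_four_mul [W.IsElliptic] {d : ℤ}
    (hd : d = -1 ∨ d = 2 ∨ d = -2)
    (hsemi : W.HasGoodReductionAtPrime 2 ∨ W.HasMultiplicativeReductionAtPrime 2)
    (hη : d = -1 ∨ W.HasMultiplicativeReductionAtPrime 2) :
    (W.quadraticTwist (4 * (d : ℚ))).IsGloballyMinimal := by
  rcases hη with rfl | hm
  · exact isGloballyMinimal_quadraticTwist_neg_four_of_semistable W hsemi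
  · exact isGloballyMinimal_quadraticTwist_four_mul_of_odd_a₁ W hd
      (odd_a₁_of_hasMultiplicativeReductionAtPrime_two W hm)

end MinimalAtTwo

end Literature.NumberTheory.EllipticCurves

end
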